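import Summits.FinalStateConjecture.FinalStateConjecture.Theses.EIHFluxBalance
import Summits.FinalStateConjecture.FinalStateConjecture.Theorems.EIHFluxBalanceModulatedKerrHandoffTrimCompositions
import Summits.FinalStateConjecture.FinalStateConjecture.Theorems.EIHFluxBalanceModulatedKerrHandoffTrimUpgradeCertificate
import HarnessLib

/-!
# Line `trim-on-the-cure` — skeleton v2 for the crux `EIHFluxBalance.ModulatedKerrHandoff`
# (item stmt-FinalStateConjecture-17402, H′ = the TAME re-type)

Planner `planner-cruxplan-stmt-FinalStateConjecture-17402-trim-on-the-cure-0` (v1, 2026-08-17, sha 8ffa7680…);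
lead `prover-line-stmt-FinalStateConjecture-17402-c3-0` (v2/v3, 2026-08-17, after wave 1; v3 = all glue imported, p151926 landed).

## v1 → v2 (lead c3)

Everything sorry-free in v1 is now LANDED under `Theorems/EIHFluxBalanceModulatedKerrHandoff*.lean`
(namespace `…Theorems.EIHFluxBalance.TameTemplate`): `CoreDefs` (p149250: `CoreHandoffClause`,
`CoreHandoffProp`, `coreHandoffClause_iff_expanded`), `TrimDefs` (p149359: `IsLocalKick`, `IsTrimmed`,
`IsTameTrimmingFamily`, `isLocalKick_const`), `TrimSchedules` (p149360: `exists_schedule`, …), `TrimPlumbing`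
(p149361: `wDist_eq_of_forall`, `patchData_kick_trim`, …), `KickTrimAssembly` (p151624: `exists_tameCurve_of_kick_trim`),
`TrimCompositions` (p151926: `tameEscapeExists_of_trim_kick`, `modulatedKerrHandoff_of_trim_kick(+_inlined)` = the
strategist's split glue T → W → K → H′; `tameEscapeExists_of_core_trim`, `modulatedKerrHandoff_of_core_trim(+_inlined)`
= this line's glue T ∧ C ∧ U → H′; `kickCensorship_of_coreLocalCure` = C ⟹ W), and wave 1's by-product
`TrimUpgradeCertificate` (p151215: `trimUpgrade_of_farTrimUpgrade` = U ⟹ U₀, the pointwise refuter target).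
So the skeleton is now: the three stubs, RESTATED BY NAME over the landed vocabulary (v1 quoted them inlined;
the registry truncates signatures at ≈ 3900 characters, so the 4105/5230-character inlined texts of C and U
could never be matched by a landing — wave-1 finding), and the one-line composition.

## Stubs (registered; `sorry` only here)

* `stub_tameEndTrimming` (T) — `∃ R₀ T M, IsTameTrimmingFamily X e d M₀ R₀ T M` for every admissible `d` on
  a sole DR end. Wave 1 (worker a00e38ce…): stub-blocked, and the planned ENGINE is dead: Mao–Oh–Tao's
  obstruction-free Thm 1.7 measures the in-datum against FLAT data, so its smallness hypothesis forces
  `R·ΔE(R) ≥ 4M₀²/μ_o`, while tameness forces `R·|M R − M₀| ≲ A(d)·wDist (T R) d → 0` (flux matched at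
  radius `R`, mass defect = integral of QUADRATIC constraint terms over `r > R`); hence no positive-energy-gap
  gluing is tame when `M₀ > 0`. What survives is CHARGE-MATCHED Kerr-end gluing (Corvino–Schoen 2006 Thm 4 /
  Chruściel–Delay 2003 Thm 8.1 / MOT Thm 1.3 up to the 10 linear obstructions: tree facts
  `MaoOhTao.GluingUpToLinearObstructionsExterior`, `MaoOhTao.ExteriorKerrFamily`, unproved) with the
  unprinted residue (C^∞ dependence on `R`, `o(1/R)` corrector, un-boosting inside the DR class) — the same
  analytic core as the sibling crux stmt-FinalStateConjecture-18522 `ExactKerrEnds.TameEscapeToKerrEnds`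
  (its registered `stub_matchedKerrGluingFamily` / `stub_nonposMassKerrEnded`). `IsTrimmed`'s class
  `(15/8, 23/8, 4, 3)` admits unboosted Kerr leaves, so T's statement is unaffected; only its engine changes.
* `stub_coreLocalCure` (C, the lead's) — through every admissible datum a local kick family whose members with
  `0 < c₀ < δ` have `CoreHandoffProp`: the open large-data core (⊇ `KickCensorship` = WCC in kick form,
  `kickCensorship_of_coreLocalCure`).
* `stub_farTrimUpgrade` (U) — core-good local kick families, tame-trimmed beyond a locally bounded threshold,
  hand off with the FULL clause. Wave 1 (worker a327a97d…): stub-blocked on route item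
  stmt-FinalStateConjecture-10183 `RecedingBasinStability` (open); no vacuity/misstatement (ρ₁ clause satisfiable
  by constants, `D′` unique by `InitialDataSet.ext'` and existing by patching, ∃-form ⇔ `HandoffPropT` by
  `handoffPropT_iff_exists` since `mghd_unique_cauchy` is proved); certificate U ⟹ U₀ landed (p151215).

Disproof used: tree `Disproof.lean` gen 3 / cycle 1 (no `_false_without_` theorem, no `-- Targets`): §4 honoured
(every member admissible; `IsMaximal` universal via `handoffPropT_iff_exists`; `[T2Space]` kept), §9 item 1 /
§11 = reason for the composite witness, §12 consistent with the core clause at `N = 0`.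
-/

set_option linter.dupNamespace false

noncomputable section

namespace Summit.FinalStateConjecture.FinalStateConjecture.Cruxes.ModulatedKerrHandoff.TrimOnTheCure

open scoped Topology Manifold ContDiff ENNReal
open Bundle Filter Set Function TopologicalSpace Literature.Geometry.Lorentzian InitialDataSet
open Summit.FinalStateConjecture.FinalStateConjecture.Theses.EIHFluxBalance
open Summit.FinalStateConjecture.FinalStateConjecture.Theorems.EIHFluxBalance.TameTemplate

/-- **STUB T — `TameEndTrimming`** (constraint gluing; tame receding end trimming of every admissible
datum on its sole DR end; engine = CHARGE-MATCHED Kerr-end gluing made tame and smooth in the radius —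
the obstruction-free Schwarzschild engine of v1 is ruled out by the mass-defect identity, see the module
docstring). By name over the landed `IsTameTrimmingFamily` (Theorems/…TrimDefs.lean); δ-unfolds to the text
of line `trim-kick-censorship`'s piece T. [cite: CorvinoSchoen2006, Thm 4] -/
theorem stub_tameEndTrimming :
    open Literature.Geometry.Lorentzian in ∀ (X : Type) [TopologicalSpace X] [ChartedSpace E3 X] [IsManifold (𝓡 3) ((⊤ : ℕ∞) : WithTop ℕ∞) X] [T2Space X] [SecondCountableTopology X] [ConnectedSpace X], ∀ d ∈ admissibleVacuumData X, ∀ (e : AFEnd X) (M₀ : ℝ), e.IsSoleEnd → e.IsStronglyAsymptoticallyFlatDR d M₀ → ∃ (R₀ : ℝ) (T : ℝ → InitialDataSet (𝓡 3) X) (M : ℝ → ℝ), Summit.FinalStateConjecture.FinalStateConjecture.Theorems.EIHFluxBalance.TameTemplate.IsTameTrimmingFamily X e d M₀ R₀ T M := by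
  sorry

/-- **STUB C — `CoreLocalCure`** (the open large-data core in local kick form: censorship + finitely
many sub-extremal holes + soft `C²` lab-chart capture with `m ∈ {1,2}` cone weights + (T),(O),(R),(QS)
+ hyperbolic recession, for the small positive members of SOME local kick family through every admissible
datum). By name over the landed `IsLocalKick` / `CoreHandoffProp`. [cite: Christodoulou1999, p. A24] -/
theorem stub_coreLocalCure :
    open Literature.Geometry.Lorentzian in ∀ (X : Type) [TopologicalSpace X] [ChartedSpace E3 X] [IsManifold (𝓡 3) ((⊤ : ℕ∞) : WithTop ℕ∞) X] [T2Space X] [SecondCountableTopology X] [ConnectedSpace X], ∀ d ∈ admissibleVacuumData X, ∃ G : EuclideanSpace ℝ (Fin 1) → InitialDataSet (𝓡 3) X, Summit.FinalStateConjecture.FinalStateConjecture.Theorems.EIHFluxBalance.TameTemplate.IsLocalKick X d G ∧ ∃ δ : ℝ, 0 < δ ∧ ∀ c : EuclideanSpace ℝ (Fin 1), 0 < c 0 → c 0 < δ → Summit.FinalStateConjecture.FinalStateConjecture.Theorems.EIHFluxBalance.TameTemplate.CoreHandoffProp X (G c) := by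
  sorry

/-- **STUB U — `FarTrimUpgrade`** (far-surgery stability + clean-class rates: core-good local families,
tame-trimmed beyond a locally bounded threshold, hand off with the FULL clause; blocked on route item
stmt-FinalStateConjecture-10183). By name over the landed vocabulary. [cite: DafermosLuk2017, Conjecture 1] -/
theorem stub_farTrimUpgrade :
    open Literature.Geometry.Lorentzian in ∀ (X : Type) [TopologicalSpace X] [ChartedSpace E3 X] [IsManifold (𝓡 3) ((⊤ : ℕ∞) : WithTop ℕ∞) X] [T2Space X] [SecondCountableTopology X] [ConnectedSpace X], ∀ d ∈ admissibleVacuumData X, ∀ (G : EuclideanSpace ℝ (Fin 1) → InitialDataSet (𝓡 3) X) (δ : ℝ), Summit.FinalStateConjecture.FinalStateConjecture.Theorems.EIHFluxBalance.TameTemplate.IsLocalKick X d G → 0 < δ → (∀ c : EuclideanSpace ℝ (Fin 1), 0 < c 0 → c 0 < δ → Summit.FinalStateConjecture.FinalStateConjecture.Theorems.EIHFluxBalance.TameTemplate.CoreHandoffProp X (G c)) → ∀ (e : AFEnd X) (M₀ R₀ : ℝ) (T : ℝ → InitialDataSet (𝓡 3) X) (M : ℝ → ℝ), e.IsSoleEnd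 → e.IsStronglyAsymptoticallyFlatDR d M₀ → Summit.FinalStateConjecture.FinalStateConjecture.Theorems.EIHFluxBalance.TameTemplate.IsTameTrimmingFamily X e d M₀ R₀ T M → ∃ ρ₁ : ℝ → ℝ, (∀ a b : ℝ, 0 < a → a ≤ b → b < δ → BddAbove (ρ₁ '' Set.Icc a b)) ∧ ∀ c : EuclideanSpace ℝ (Fin 1), 0 < c 0 → c 0 < δ → ∀ R : ℝ, R₀ ≤ R → ρ₁ (c 0) ≤ R → ∀ D' ∈ admissibleVacuumData X, (∀ x ∉ e.far R, D'.h.inner x = (G c).h.inner x ∧ D'.k x = (G c).k x) → (∀ x ∈ e.far R, D'.h.inner x = (T R).h.inner x ∧ D'.k x = (T R).k x) → ∃ 𝒟 : VacuumCauchyDevelopment D', 𝒟.IsMaximal ∧ Summit.FinalStateConjecture.FinalStateConjecture.Theorems.EIHFluxBalance.TameTemplate.HandoffClause X D' 𝒟 := by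
  sorry

/-- **COMPOSITION.** `ModulatedKerrHandoff` from the three stubs (the crux BY NAME; the route decl
`δ`-unfolds to the verbatim body concluded by the landed `modulatedKerrHandoff_of_core_trim`). -/
theorem ModulatedKerrHandoff_of : ModulatedKerrHandoff :=
  modulatedKerrHandoff_of_core_trim stub_tameEndTrimming stub_coreLocalCure stub_farTrimUpgrade

/-- Read-back (information): U also yields the pointwise, family-free upgrade U₀ of wave 1's certificate
(`trimUpgrade_of_farTrimUpgrade`, p151215) — recorded so that the disprover's target for U is visible from
the skeleton. [folklore] -/
theorem shape_note : True := trivial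

end Summit.FinalStateConjecture.FinalStateConjecture.Cruxes.ModulatedKerrHandoff.TrimOnTheCure

end
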